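import Summits.Ventures.HSemireg.GeneralStructureWiring
import Summits.Ventures.HSemireg.GeneralStructureWiringBloch
import Summits.Ventures.HSemireg.GeneralStructureWiringPrimitiveMiddle
import Summits.Ventures.HSemireg.GeneralStructureWiringAnchor
import HarnessLib

/-!
# HSemireg venture · general structure (G4) — the WIRING, LADDER: how the four typed forms of «uniform semiregularity at CM points»
# relate, and what the WEIL SUB-CASE (the team's tables) reaches

HONEST FRAMING (speculative tier of cell `pub-hsemireg`, team «general structure», seat G4; verbatim the cell's wording rule):
**nothing here says `HC_AV` or `HC_CM` is proved; every implication carries its named hypotheses.** No `sorry`, no new definition,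
no new axiom; axioms `propext`, `Classical.choice`, `Quot.sound`. `HC_CM` = `Theses.RankFourFaces.CMAbelianHodge` (stmt-3052, binder);
`HC_AV` = `Theses.PadicSemiregularLift.HodgeAbelianVarieties` (stmt-1333).

The four companion files type the team's hypothesis in four forms — `UniformSemiregularSheafLiftAtCM C` (sheaf, every CM fibre),
`UniformBlochLiftAtCM` (cycle, every CM fibre), `…PrimitiveMiddle` (both, thinned to fibrewise-primitive middle classes `2p = m ≥ 4`),
`ExistsSemiregularSheafCMAnchor C` (sheaf, ONE CM fibre per CM-anchored family) — each landing in `HC_AV ↔ HodgeWeilType` modulo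
named printed facts and `HC_CM`. This file records (kernel-checked one-liners and one typing conversion):

* L-1 `uniformSheafLiftPrimitiveMiddle_of_uniformSheafLift`, `uniformBlochLiftPrimitiveMiddle_of_uniformBlochLift` — ∀-form ⟹ thinned form;
* L-2 `existsAnchor_of_uniformSheafLift` — ∀-form ⟹ ∃-form (take the anchor Deligne supplies);
* L-3 `semiregularChernLiftAtCMQuadratic_of_uniformSheafLift` — **the ∀-form SPECIALISES to ring 2's Weil-confined quadratic leaf
  `Ring2Transport.SemiregularChernLiftAtCMQuadratic C`** (typing conversions only: Milne's `IsOfCMType` ↔ the eigenvalue typing `IsCM`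
  by `CMPivot.isCM_iff_exists_cmSubalgebra`; rationality / Hodge type / algebraicity along the chart by the tree's `IsoTransport`
  lemmas; `dim B = 2n` by `Ring2.Binders.dim_eq_of_iso_fiberOver`). So the team's Weil tables (quadratic `K`, `(n,n)`, `n = 2 … 5`)
  are LITERALLY instances of the Weil sub-case of the hypothesis of record;
* L-4 **THE HONEST TERMINUS OF THE WEIL SUB-CASE** (RED-GS finding GS-1, transport intake §2): through ring 2's row T7-germ
  (`Ring2Transport.HC_WeilClassesQuadratic_of_HC_CM_of_semiregularChernLift`, `…CMPivot.hc_dimLeFive_…`) the Weil-confined lift reaches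
  rung R∞ `WeilTypeLadder.WeilClassesImaginaryQuadratic` (Weil CLASSES algebraic on every `ℚ(√-d)`-Weil `2n`-fold, `n ≥ 2`) and, with
  Moonen–Zarhin 1999 (named fact), `HC(dim ≤ 5)` (`Theses.SevenfoldWeilCensus.HodgeAbelianDimLeFive`, stmt-18723) — NOT `HodgeWeilType`
  (= `HC_AV`, ring 2's exactness), which needs the all-Hodge-classes forms of the companions (`ladder_position`).

## References (bib keys)

BuchweitzFlenner2003 (§5 Thm. 5.1), Bloch1972Semiregularity (Thm. 7.4), Deligne1982HodgeCycles (Prop. 6.1; §4–5),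
CharlesSchnell2014Notes (Prop. 11.3.11, Thm. 11.5.11), MoonenZarhin1999 (dim ≤ 5), vanGeemen1994HodgeAV (4.9, Thm. 6.12),
MumfordAV1970 (§22), Markman2025SurveySecant (Question 11.4; preprint, unrefereed — statement only).
-/

noncomputable section

open CategoryTheory
open Literature.AlgebraicGeometry Literature.AlgebraicGeometry.Motives
open Literature.AlgebraicGeometry.HodgeTheory
open Literature.AlgebraicGeometry.Milne1999 (IsOfCMType)

namespace Summit.Ventures.HSemireg.GeneralStructure

open Summit.HodgeConjecture.HodgeConjecture
open Summit.HodgeConjecture.HodgeConjecture.Ring2.Hypotheses (hc_dimLeFive_of_hc_cm_of_cmPointedQuadratic_of_localWeilVHCAtCM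
  hc_av_iff_hc_cm_and_cmToAbelian)
open Summit.HodgeConjecture.HodgeConjecture.Ring2Transport (HodgeWeilType SemiregularChernLiftAtCMQuadratic
  CMPointedWeilFamiliesQuadratic localWeilVHCAtCMQuadratic_of_semiregularChernLift
  HC_WeilClassesQuadratic_of_HC_CM_of_semiregularChernLift hodgeAbelianVarieties_iff_hodgeWeilType
  cmToAbelian_iff_hodgeWeilType_of_cmAbelianHodge)
open Summit.HodgeConjecture.HodgeConjecture.Theorems.HodgeAbelianVarieties.CMPivot (isCM_iff_exists_cmSubalgebra)
open Summit.HodgeConjecture.HodgeConjecture.WeilTypeLadder (WeilClassesImaginaryQuadratic)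

/-! ### §1 ∀-form ⟹ thinned form ⟹ (nothing lost on the tables); ∀-form ⟹ ∃-form -/

/-- **L-1 (sheaf)**: the ∀-form gives its primitive-middle thinning (drop the three numeric binders and the polarisation clause).
[cite: BuchweitzFlenner2003, §5 Thm. 5.1] -/
theorem uniformSheafLiftPrimitiveMiddle_of_uniformSheafLift (C : ChernCharacterBetti) (hL : UniformSemiregularSheafLiftAtCM C) :
    UniformSemiregularSheafLiftAtCMPrimitiveMiddle C :=
  fun S 𝒳 f m p G s₀ A₀ e₀ _ _ _ h𝒳 hS hsm hirr hf hA₀ hcm halg hG _ _ _ ↦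
    hL S 𝒳 f m p G s₀ A₀ e₀ h𝒳 hS hsm hirr hf hA₀ hcm halg hG

/-- **L-1 (cycle)**: the ∀-form gives its primitive-middle thinning. [cite: Bloch1972Semiregularity, Thm. (7.4)] -/
theorem uniformBlochLiftPrimitiveMiddle_of_uniformBlochLift (hL : UniformBlochLiftAtCM) : UniformBlochLiftAtCMPrimitiveMiddle :=
  fun S 𝒳 f m p G s₀ A₀ e₀ _ _ _ h𝒳 hS hsm hirr hf hA₀ hcm halg hG _ _ _ ↦
    hL S 𝒳 f m p G s₀ A₀ e₀ h𝒳 hS hsm hirr hf hA₀ hcm halg hG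

/-- **L-2**: the ∀-form gives the per-component ∃-form — answer with the CM fibre the family comes anchored at (its class is algebraic
there by the ∃-form's own antecedent). [cite: Deligne1982HodgeCycles, Prop. 6.1] [cite: BuchweitzFlenner2003, §5 Thm. 5.1] -/
theorem existsAnchor_of_uniformSheafLift (C : ChernCharacterBetti) (hL : UniformSemiregularSheafLiftAtCM C) :
    ExistsSemiregularSheafCMAnchor C := by
  intro S 𝒳 f m p G h𝒳 hS hsm hirr hf hG hanch halg
  obtain ⟨s₀, A₀, e₀, hA₀, hcm⟩ := hanch
  exact ⟨s₀, A₀, e₀, hA₀, hcm, hL S 𝒳 f m p G s₀ A₀ e₀ h𝒳 hS hsm hirr hf hA₀ hcm (halg s₀ A₀ e₀ hA₀ hcm) hG⟩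

/-! ### §2 L-3: the ∀-form specialises to ring 2's Weil-confined quadratic leaf (the tables' cell) -/

/-- **L-3 — `UniformSemiregularSheafLiftAtCM C ⟹ Ring2Transport.SemiregularChernLiftAtCMQuadratic C`.** In the binders of ring 2's
Weil-confined leaf (`n ≥ 2`, `d ≥ 1`, a smooth projective `ℚ(√-d)`-Weil family of relative dimension `2n` over a smooth irreducible
quasi-projective base, `W` fibrewise rational `(n,n)` and Weil-charted, a CM-presented fibre `A₀ ≅ 𝒳_{s₀}` in Milne's typing
`IsOfCMType`, `W|_{𝒳_{s₀}}` algebraic) the ∀-form applies: `IsOfCMType A₀ ↔ IsCM[A₀]` (`CMPivot.isCM_iff_exists_cmSubalgebra`,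
Mumford §22); the chart `A₀.X ≅ 𝒳_{s₀} ↪ 𝒳` presents the fibre; algebraicity, rationality and Hodge type move along isomorphisms
(`mem_algebraicClasses_map_iff_of_iso`, `isRationalClass_map_iff_of_iso`, `isOfHodgeType_map_iff_of_iso`); an abelian fibre of a
family of relative dimension `2n` has dimension `2n` (`Ring2.Binders.dim_eq_of_iso_fiberOver`). The Weil charts are not used: the
∀-form is blind to the Weil confinement. [cite: MumfordAV1970, §22] [cite: BuchweitzFlenner2003, §5 Thm. 5.1]
[cite: vanGeemen1994HodgeAV, 4.9] -/
theorem semiregularChernLiftAtCMQuadratic_of_uniformSheafLift (C : ChernCharacterBetti)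
    (hL : UniformSemiregularSheafLiftAtCM C) : SemiregularChernLiftAtCMQuadratic C := by
  intro n _ d _ 𝒳 S f hf hq𝒳 hqS hirr hsm W hW _ s₀ hA₀ halg
  obtain ⟨A₀, ⟨e₀⟩, _, hcm₀⟩ := hA₀
  have hcm := (isCM_iff_exists_cmSubalgebra A₀).2 hcm₀
  have he₀ : complexBetti.map (e₀.hom ≫ fiberι f s₀) (2 * n) W =
      complexBetti.map e₀.hom (2 * n) (complexBetti.map (fiberι f s₀) (2 * n) W) := by
    rw [complexBetti.map_comp]
    rfl
  have halg' : complexBetti.map (e₀.hom ≫ fiberι f s₀) (2 * n) W ∈ algebraicClasses A₀.X n := by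
    rw [he₀]
    exact (mem_algebraicClasses_map_iff_of_iso e₀).2 halg
  have hG : ∀ (B : AbelianVariety ℂ) (eB : B.X ⟶ 𝒳) (u : ComplexPoints S),
      (∃ i : B.X ≅ fiberOver f u, eB = i.hom ≫ fiberι f u) →
        IsRationalClass (complexBetti.map eB (2 * n) W) ∧
          IsOfHodgeType B.dim B.X (2 * n) n n (complexBetti.map eB (2 * n) W) := by
    rintro B eB u ⟨iB, hiB⟩
    have hBdim : B.dim = 2 * n := Ring2.Binders.dim_eq_of_iso_fiberOver hf iB
    have he : complexBetti.map eB (2 * n) W =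
        complexBetti.map iB.hom (2 * n) (complexBetti.map (fiberι f u) (2 * n) W) := by
      rw [hiB, complexBetti.map_comp]
      rfl
    rw [he, hBdim]
    exact ⟨(isRationalClass_map_iff_of_iso iB).2 (hW u).1, (isOfHodgeType_map_iff_of_iso iB).2 (hW u).2⟩
  exact hL S 𝒳 f (2 * n) n W s₀ A₀ (e₀.hom ≫ fiberι f s₀) hq𝒳 hqS hsm hirr hf ⟨e₀, rfl⟩ hcm halg' hG

/-! ### §3 L-4: the honest terminus of the Weil sub-case — rung R∞ and HC(dim ≤ 5), not `HodgeWeilType` -/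

/-- **L-4 (R∞) — `HC_CM ∧ CMPointedWeilFamiliesQuadratic ∧ [Buchweitz–Flenner 5.1] ∧ UniformSemiregularSheafLiftAtCM ⟹ R∞`**
(`WeilTypeLadder.WeilClassesImaginaryQuadratic`: the Weil classes are algebraic on EVERY `ℚ(√-d)`-Weil abelian `2n`-fold, `n ≥ 2`,
`d ≥ 1`, every discriminant, every member), by L-3 and ring 2's row T7-germ. This is what the Weil-confined part of the hypothesis —
the part the team's tables test — buys; `HC_CM` is NOMINAL on this row in print (the diagonal CM member `E^{2n}` has a
divisor-generated Hodge ring; ring 2's `HC_CM`-free twin `HC_WeilClassesQuadratic_of_divisorGeneratedCMPointed_of_semiregularChernLift`).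
[cite: BuchweitzFlenner2003, §5 Thm. 5.1] [cite: Deligne1982HodgeCycles, §4–5] [cite: CharlesSchnell2014Notes, Prop. 11.3.11 (proof)] -/
theorem weilClassesImaginaryQuadratic_of_hc_cm_of_cmPointedQuadratic_of_buchweitzFlenner_of_uniformSheafLift
    (C : ChernCharacterBetti) (hCM : Theses.RankFourFaces.CMAbelianHodge) (hP : CMPointedWeilFamiliesQuadratic)
    (hBF : BuchweitzFlenner2003_variationalHodge_ISemiregular) (hL : UniformSemiregularSheafLiftAtCM C) :
    WeilClassesImaginaryQuadratic :=
  HC_WeilClassesQuadratic_of_HC_CM_of_semiregularChernLift C hCM hP (semiregularChernLiftAtCMQuadratic_of_uniformSheafLift C hL) hBF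

/-- **L-4 (dim ≤ 5) — … ∧ [Moonen–Zarhin 1999] ⟹ HC for every complex abelian variety of dimension `≤ 5`**
(`Theses.SevenfoldWeilCensus.HodgeAbelianDimLeFive`, stmt-HodgeConjecture-18723), by ring 2's Moonen–Zarhin reading of the local
quadratic leaf. The Weil sub-case tops out here (and, over general CM fields with André 1992, at `HC_CM` — ring 2's
`HC_CM_iff_weilRungs_of_andre_of_transport`; not restated). [cite: MoonenZarhin1999, Thm. (dim ≤ 5)]
[cite: BuchweitzFlenner2003, §5 Thm. 5.1] -/
theorem hodgeAbelianDimLeFive_of_hc_cm_of_cmPointedQuadratic_of_buchweitzFlenner_of_uniformSheafLift_of_moonenZarhin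
    (C : ChernCharacterBetti) (hCM : Theses.RankFourFaces.CMAbelianHodge) (hP : CMPointedWeilFamiliesQuadratic)
    (hBF : BuchweitzFlenner2003_variationalHodge_ISemiregular) (hL : UniformSemiregularSheafLiftAtCM C)
    (hMZ : MoonenZarhin1999_hodgeClasses_abelian_dim_le_five_of_weilClassesFourfolds) :
    Theses.SevenfoldWeilCensus.HodgeAbelianDimLeFive :=
  hc_dimLeFive_of_hc_cm_of_cmPointedQuadratic_of_localWeilVHCAtCM hCM hP
    (localWeilVHCAtCMQuadratic_of_semiregularChernLift C hBF (semiregularChernLiftAtCMQuadratic_of_uniformSheafLift C hL)) hMZ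

/-! ### §4 Position of the ladder -/

/-- **LADDER POSITION (conjunction of tree theorems; RED-GS GS-1 in kernel form).** (a)–(c) the ∀-form implies the thinned form, the
∃-form and ring 2's Weil-confined quadratic leaf; (d) the Weil-confined leaf reaches ring 2's LOCAL Weil leaf (BF 5.1) — whose termini
are R∞ / HC(dim ≤ 5) (§3); (e) `HodgeWeilType` IS `HC_AV` and (f) `(HC_CM → HodgeWeilType)` IS the open item `CMToAbelian`
(stmt-16267): nothing Weil-confined closes them; the all-Hodge-classes forms of the companions do, modulo their named hypotheses
(rows G4-2′, B-2, PM-2, A-1′). [cite: Deligne1982HodgeCycles, Prop. 6.1 and §4] [cite: BuchweitzFlenner2003, §5 Thm. 5.1]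
[cite: vanGeemen1994HodgeAV, 4.9 and Thm. 6.12] -/
theorem ladder_position (C : ChernCharacterBetti) :
    (UniformSemiregularSheafLiftAtCM C → UniformSemiregularSheafLiftAtCMPrimitiveMiddle C) ∧
    (UniformSemiregularSheafLiftAtCM C → ExistsSemiregularSheafCMAnchor C) ∧
    (UniformSemiregularSheafLiftAtCM C → SemiregularChernLiftAtCMQuadratic C) ∧
    (BuchweitzFlenner2003_variationalHodge_ISemiregular → SemiregularChernLiftAtCMQuadratic C →
      Ring2Transport.LocalWeilVHCAtCMQuadratic) ∧
    (Theses.PadicSemiregularLift.HodgeAbelianVarieties ↔ HodgeWeilType) ∧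
    (Theses.RankFourFaces.CMToAbelian ↔ (Theses.RankFourFaces.CMAbelianHodge → HodgeWeilType)) :=
  ⟨uniformSheafLiftPrimitiveMiddle_of_uniformSheafLift C, existsAnchor_of_uniformSheafLift C,
    semiregularChernLiftAtCMQuadratic_of_uniformSheafLift C, localWeilVHCAtCMQuadratic_of_semiregularChernLift C,
    hodgeAbelianVarieties_iff_hodgeWeilType, cmToAbelian_iff_hodgeWeilType_of_cmAbelianHodge⟩

/-! ## Audit: nothing is decided here

No new definition. Every theorem above is an implication between NAMED typed statements of the tree (the team's speculative lifts,
ring 2's leaves and rungs, printed facts as binders, `HC_CM` by name) or a conjunction of such. Axiom closures: the three standard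
axioms only. -/

#print axioms Summit.Ventures.HSemireg.GeneralStructure.semiregularChernLiftAtCMQuadratic_of_uniformSheafLift
#print axioms Summit.Ventures.HSemireg.GeneralStructure.weilClassesImaginaryQuadratic_of_hc_cm_of_cmPointedQuadratic_of_buchweitzFlenner_of_uniformSheafLift
#print axioms Summit.Ventures.HSemireg.GeneralStructure.ladder_position

end Summit.Ventures.HSemireg.GeneralStructure

end
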